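import Summits.Ventures.PercRepro2.CaseOneRootsAndBIQClass
import Summits.Ventures.PercRepro2.CaseOneMovesAnchors

/-!
# Every absent-edge face of a closed class is closed (blind cell PercRepro2, p1 g28; the general
form of the null-edge extension, and two more star rows)

`closedAt_of_ext`: if the statement vertex is closed in the graph extended by one null edge (ends `s`),
it is closed in the graph — all four forms transfer across the null edge (`Dpd_ext`, `Dpdo_ext`,
`zSplitII_of_ext`, `zSplitI_of_ext` complete `zSplitIIQ_of_ext` / `zSplitIQ_of_ext` of
`CaseOneRootsAndBIQClass`). Applied to the marked star (a closed anchor): the single-edge stars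
`a₃ ~ {a₁, o, b}` and `a₃ ~ {a₂, o, b}` are closed (**`closedAt_of_a1ob`**, **`closedAt_of_a2ob`**),
and `a₃ ~ {a₁, a₂, b}` again (`closedAt_of_rootsAndB_single'`). Own code; standard axioms.
-/

universe u

namespace Summit.Ventures.PercRepro2

namespace CaseOne

section ExtPD
variable {V : Type*} {E : Type*} [Fintype E] [DecidableEq E] {R : Type*} [CommRing R]

/-- `Dpd` across the null new edge. -/
theorem Dpd_ext (p : E → R) (ends : E → Sym2 V) (s : Sym2 V) (a₁ a₂ a₃ : V) :
    Dpd (extW p) (extEnds ends s) a₁ a₂ a₃ = Dpd p ends a₁ a₂ a₃ := by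
  unfold Dpd
  exact prob_ext p _ _ fun ω => by
    simp only [Set.mem_inter_iff, Set.mem_compl_iff, mem_connEvent_ext]

/-- `Dpdo` across the null new edge. -/
theorem Dpdo_ext (p : E → R) (ends : E → Sym2 V) (s : Sym2 V) (o a₁ a₂ a₃ : V) :
    Dpdo (extW p) (extEnds ends s) o a₁ a₂ a₃ = Dpdo p ends o a₁ a₂ a₃ := by
  unfold Dpdo
  exact prob_ext p _ _ fun ω => by
    simp only [Set.mem_inter_iff, Set.mem_union, Set.mem_compl_iff, mem_connEvent_ext]

end ExtPD

section ExtForms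
variable {V : Type*} {E : Type*} [Fintype E] [DecidableEq E] {R : Type*} [CommRing R]
  [LinearOrder R]

/-- **`(ii)` transfers from the extension to `G`.** -/
theorem zSplitII_of_ext {p : E → R} {ends : E → Sym2 V} {s : Sym2 V} {o a₁ a₂ a₃ b : V}
    (h : ZSplitII (extW p) (extEnds ends s) o a₁ a₂ a₃ b) : ZSplitII p ends o a₁ a₂ a₃ b := by
  unfold ZSplitII at h ⊢
  rw [iiExpr_eq_iiExprT] at h ⊢
  rw [iiExprT_ext, Dpd_ext, Dpdo_ext] at h
  exact h

/-- **`(i)` transfers from the extension to `G`.** -/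
theorem zSplitI_of_ext {p : E → R} {ends : E → Sym2 V} {s : Sym2 V} {o a₁ a₂ a₃ b : V}
    (h : ZSplitI (extW p) (extEnds ends s) o a₁ a₂ a₃ b) : ZSplitI p ends o a₁ a₂ a₃ b := by
  unfold ZSplitI at h ⊢
  rw [iExpr_eq_iExprT] at h ⊢
  rw [iExprT_ext, Dpd_ext, Dpdo_ext] at h
  exact h

/-- **The four forms transfer from the extension to `G`.** -/
theorem fourForms_of_ext {p : E → R} {ends : E → Sym2 V} {s : Sym2 V} {o a₁ a₂ a₃ b : V}
    (h : FourForms (extW p) (extEnds ends s) o a₁ a₂ a₃ b) : FourForms p ends o a₁ a₂ a₃ b :=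
  ⟨zSplitII_of_ext h.1, zSplitIIQ_of_ext h.2.1, zSplitI_of_ext h.2.2.1, zSplitIQ_of_ext h.2.2.2⟩

end ExtForms

section ExtClosed
variable {V : Type*} {E : Type u} [Fintype E] [DecidableEq E] {R : Type*} [Field R]
  [LinearOrder R] [IsStrictOrderedRing R]

/-- **Every absent-edge face of a closed graph is closed**: `ClosedAt` transfers from the graph
extended by a null edge to the graph. -/
theorem closedAt_of_ext {ends : E → Sym2 V} {s : Sym2 V} {o a₁ a₂ a₃ b : V}
    (h : ClosedAt R o a₁ a₂ b (Option E) (extEnds ends s) a₃) : ClosedAt R o a₁ a₂ b E ends a₃ :=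
  fun p hp => fourForms_of_ext (h (extW p) (isProbVec_extW hp))

end ExtClosed

section Stars
variable {V : Type*} [Fintype V] [DecidableEq V] {E : Type u} [Fintype E] [DecidableEq E]
  {R : Type*} [Field R] [LinearOrder R] [IsStrictOrderedRing R]
variable {ends : E → Sym2 V} {o a₁ a₂ a₃ b : V} {e₁ eo eb : E}

/-- **`a₃ ~ {a₁, o, b}` through single edges is closed**: a null edge to `a₂` makes it the marked
star. -/
theorem closedAt_of_a1ob (he₁ : ends e₁ = s(a₁, a₃)) (heo : ends eo = s(o, a₃))
    (heb : ends eb = s(b, a₃)) (h1o : e₁ ≠ eo) (h1b : e₁ ≠ eb) (hob : eo ≠ eb)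
    (hunique : ∀ e, a₃ ∈ ends e → e = e₁ ∨ e = eo ∨ e = eb) (h1 : a₁ ≠ a₃) (h2 : a₂ ≠ a₃)
    (ho : o ≠ a₃) (hb : b ≠ a₃) : ClosedAt R o a₁ a₂ b E ends a₃ := by
  refine closedAt_of_ext (s := s(a₂, a₃)) (closedAt_of_closedAnchor o a₁ a₂ b _ _ a₃ ?_)
  refine Or.inr (Or.inl ⟨some e₁, none, some eo, some eb, ?_⟩)
  exact
    { ends_1 := by simp [he₁]
      ends_2 := rfl
      ends_o := by simp [heo]
      ends_b := by simp [heb]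
      ne_12 := by simp
      ne_1o := by simp [h1o]
      ne_1b := by simp [h1b]
      ne_2o := by simp
      ne_2b := by simp
      ne_ob := by simp [hob]
      unique := by
        intro e he
        cases e with
        | none => exact Or.inr (Or.inl rfl)
        | some e =>
          rcases hunique e he with h | h | h
          · exact Or.inl (by rw [h])
          · exact Or.inr (Or.inr (Or.inl (by rw [h])))
          · exact Or.inr (Or.inr (Or.inr (by rw [h])))
      ne_a1 := h1
      ne_a2 := h2
      ne_o := ho
      ne_b := hb }

/-- **`a₃ ~ {a₂, o, b}` through single edges is closed**: a null edge to `a₁` makes it the marked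
star. -/
theorem closedAt_of_a2ob (he₂ : ends e₁ = s(a₂, a₃)) (heo : ends eo = s(o, a₃))
    (heb : ends eb = s(b, a₃)) (h2o : e₁ ≠ eo) (h2b : e₁ ≠ eb) (hob : eo ≠ eb)
    (hunique : ∀ e, a₃ ∈ ends e → e = e₁ ∨ e = eo ∨ e = eb) (h1 : a₁ ≠ a₃) (h2 : a₂ ≠ a₃)
    (ho : o ≠ a₃) (hb : b ≠ a₃) : ClosedAt R o a₁ a₂ b E ends a₃ := by
  refine closedAt_of_ext (s := s(a₁, a₃)) (closedAt_of_closedAnchor o a₁ a₂ b _ _ a₃ ?_)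
  refine Or.inr (Or.inl ⟨none, some e₁, some eo, some eb, ?_⟩)
  exact
    { ends_1 := rfl
      ends_2 := by simp [he₂]
      ends_o := by simp [heo]
      ends_b := by simp [heb]
      ne_12 := by simp
      ne_1o := by simp
      ne_1b := by simp
      ne_2o := by simp [h2o]
      ne_2b := by simp [h2b]
      ne_ob := by simp [hob]
      unique := by
        intro e he
        cases e with
        | none => exact Or.inl rfl
        | some e =>
          rcases hunique e he with h | h | h
          · exact Or.inr (Or.inl (by rw [h]))
          · exact Or.inr (Or.inr (Or.inl (by rw [h])))
          · exact Or.inr (Or.inr (Or.inr (by rw [h])))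
      ne_a1 := h1
      ne_a2 := h2
      ne_o := ho
      ne_b := hb }

/-- **`a₃ ~ {a₁, a₂, b}` through single edges is closed** — a second proof, through the closed
anchor. -/
theorem closedAt_of_rootsAndB_single' {e₂ : E} (he₁ : ends e₁ = s(a₁, a₃))
    (he₂ : ends e₂ = s(a₂, a₃)) (heb : ends eb = s(b, a₃)) (h12 : e₁ ≠ e₂) (h1b : e₁ ≠ eb)
    (h2b : e₂ ≠ eb) (hunique : ∀ e, a₃ ∈ ends e → e = e₁ ∨ e = e₂ ∨ e = eb) (h1 : a₁ ≠ a₃)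
    (h2 : a₂ ≠ a₃) (ho : o ≠ a₃) (hb : b ≠ a₃) : ClosedAt R o a₁ a₂ b E ends a₃ :=
  closedAt_of_ext (s := s(o, a₃)) (closedAt_of_closedAnchor o a₁ a₂ b _ _ a₃
    (Or.inr (Or.inl ⟨some e₁, some e₂, none, some eb,
      isMarkedStarAt_ext he₁ he₂ heb h12 h1b h2b hunique h1 h2 ho hb⟩)))

end Stars

end CaseOne

end Summit.Ventures.PercRepro2
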